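import Summits.QuantumFields.YangMills.Theorems.BalabanUVNodesK0Stub3RunwiseFace

/-!
# K0⁷ V19 — STUB 3ᴬ′'s WEAKEST (j, c)-GENERIC SUB-FACE READ BY THE K0 NODE: 3ᶜ «CONSECUTIVE COUPLINGS ARE 2-COMPARABLE ALONG THE IN-WINDOW RUNS OF A1's WITNESS»
# ([III] (2.6)–(2.8) «from the renormalization group equations (0.20) and from the properties of the β-functions»), and the road 3ᴬ′ ⟹ 3ᴿ ⟹ 3ᶜ ⟹ K0⁷ BY NAME

Cell `pub-ymgap`, width seat `pub-ymgap-k0-s3-w2` (g0; director-ym R399 (3a) ∕ №207 «(j,c)-generic sub-faces of `stub_absBetaBoxAtThm1WitnessCCMGen13` by CLAIM»; bus CLAIM-3).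
`--kind proof --supports stmt-QuantumFields-20541 --as helper` (count-neutral).  NEW leaf over `…K0Stub3RunwiseFace` (p607023 ✓); theorems only; 0 `def`; nothing modified; no registry write.
[15] = [Balaban1985Variational]; [6] = [Balaban1985RegularSpaces]; [I] = [Balaban1987RG1]; [II] = [Balaban1989LargeFieldII]; [III] = [Balaban1988Convergent].

WHY.  The K0 node reads the β-side ONLY through the two history clauses (hcomp) ∧ (hcompRev) of row `bg` — `ε_m ≤ 2ε_{m+1}` and `ε_{m+1} ≤ 2ε_m` along the windowed runs, `ε_k = g_k·A₀·log g_k⁻²`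
([III] (2.4), (2.6)–(2.8)) — and `…K0Stub3RunwiseFace.hcompBoth_genSeq_of_runBetaBoxSignFree` derives them from a two-sided β-bound in two moves: (i) ONE RG step `g′⁻² = g⁻² − β` with
`β·g² ≤ ¾` ∕ `−β·g² ≤ 3` gives `g′ ≤ 2g` ∕ `g ≤ 2g′` (`Node00.le_two_mul_of_inv_sq_step_upper ∕ _lower`); (ii) the (2.4) profile is 2-comparable along 2-comparable couplings in `]0, ½]`
(`Node00.epsOfRecord_le_two_mul_of_le_two_mul`).  Move (ii) reads NO β at all.  Hence the WEAKEST β-side letter the node consumes is the conclusion of (i):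

  3ᶜ(F) := ∀ (j c) (B₃ B₃′ a₀ a₁), c ≤ L^j → 2L² ≤ B₃ → 0 < B₃′ → 0 < a₀ → 0 < a₁ → (8)-sentence → (9)-token at (L^j, c) →
           ∃ γ₀ ε₀ ε₂₉, 0 < γ₀ ∧ 0 < ε₀ ∧ 0 < ε₂₉ ∧ ∀ n gs, RGEqH n β₁₃(θ₁₅ᶜᶜᴹ(j; ε₀, ε₂₉; …)) gs → Step.InInterval γ₀ n gs → ∀ m < n, gs m ≤ 2·gs (m+1) ∧ gs (m+1) ≤ 2·gs m

(3ᴬ′'s (j,c)-generic prefix VERBATIM; clause = «along every solution of (0.20) for the witness's β staying in `]0, γ₀]`, consecutive couplings differ by at most a factor 2» — equivalently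
`−3·g_m⁻² ≤ β_m(g_0,…,g_m)` and `β_m(g_0,…,g_m) ≤ ¾·g_m⁻²` along those runs: a SCALE-COVARIANT bound, weaker than any uniform `|β| ≤ β′` near `g = 0`).  3ᴿ ⟹ 3ᶜ (§0, window shrink) and
3ᶜ ⟹ K0⁷ with stubs 1, 2′ (§3–§4) — so the chain of (j,c)-generic sub-faces of the registered socket reads 3ᴬ′ ⟹ 3ᴿ ⟹ 3ᶜ ⟹ (hcomp) ∧ (hcompRev), each BY NAME in the tree, and a supplier
may enter at the weakest level it can certify.  3ᶜ is spelled inline (no `def`); V19 STANDS.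

CONTENTS (0 `def`, 0 `sorry`).  §0 generic: ★ `hcompBoth_genSeq_of_twoComparable` (move (ii) alone), `twoComparable_of_rgEqH_of_runBetaBox` (move (i) exposed), ★ `exists_twoComparable_of_runConstRemainder`
(3ᴿ's letter at level `γ₀` ⟹ the comparability letter at a level `γ ≤ min γ₀ ½`), `twoComparable_mono` (level-antitone).  §1 θ-generic consumer `hcompBoth_of_twoComparable`.  §2 the CCM → CCMW
transfer along runs `twoComparable_theta13OfThm1CCMW_of_half` + ★ `hcompBoth_theta13OfThm1CCMW_of_twoComparable_half`.  §3 ★ `clausesH_of_twoComparable`, ★ `exists_k0H_of_thm1CoP7M_of_gauge9R_of_twoComparable`.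
§4 ★★ `record13SepCoPHBody_of_stub1_of_gauge9Supplier_of_twoComparableAt`, ★★ `record13SepCoPHInhabited_of_stub1_stub2P_comp3C`, ★★★ `record13SepCoPHInhabited_of_stub1_comp3C_byName`, `comp3C_of_run3R`
(3ᴿ ⟹ 3ᶜ at one family), `comp3C_of_abs3A'` (3ᴬ′ ⟹ 3ᶜ), and the sanity (`example`) that V19's composition factors through 3ᶜ.  §5 `twoComparable_not_runConstRemainder_model`: on the MODEL family
`β_{k+1} := 1∕(2g_k²)` (NOT the β of record) the comparability letter holds at every level while no run-wise uniform bound does — 3ᶜ is strictly weaker than 3ᴿ as a letter shape.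

HONEST FRAMING.  Elementary real arithmetic + by-name compositions; 3ᶜ ∕ 3ᴿ ∕ 3ᴬ′ are DISPLAYED hypotheses — NODE O's wall ([I] §1 p.264 «uniformly bounded» STATED, proof unpublished [II] p.355;
[III] (2.6)–(2.8) ASSUMED in print «from … the properties of the β-functions»); nothing of Bałaban asserted; no stub proved; K0⁷ stmt-QuantumFields-20541 OPEN; counts unmoved (5∕28) — count
words are the chair's.  One finite 𝕋⁴ programme at fixed `ε = L^{−K}`, Bałaban AS PRINTED — NOT continuum ∕ ℝ⁴ ∕ OS ∕ mass gap ∕ Clay: the Yang–Mills mass gap is NOT proved by any of this;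
route R4 closes the CONDITIONAL finite-𝕋⁴ rung `BalabanLadder.UV` only.  No `sorry`, `def`, `instance`, `notation`, `axiom`.
-/

noncomputable section

open scoped Matrix.Norms.L2Operator

namespace Summit.QuantumFields.YangMills.Theorems.K0Stub3ComparabilityFace

open Literature.MathematicalPhysics.QuantumFieldTheory.Balaban1983to89
open Literature.MathematicalPhysics.QuantumFieldTheory.Balaban1983to89.Node00
open Literature.MathematicalPhysics.QuantumFieldTheory.Balaban1983to89.T4Continuum
open Literature.MathematicalPhysics.QuantumFieldTheory.Balaban1983to89.FlowStep
open Literature.MathematicalPhysics.QuantumFieldTheory.Balaban1983to89.FlowStepRuns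
open Summit.QuantumFields.YangMills.Theorems.BalabanUVNodesK2NamedJetsRunRemAt (RunConstRemainder)
open Summit.QuantumFields.YangMills.Theorems.K0V19Defs (Prop8StepCoPAt Prop6MemberB8AtP AbsBetaBoxAtThm1WitnessCCMGenAt K0HBodyAt)
open Summit.QuantumFields.YangMills.Theorems.K0V19Stub2Prime (stub_prop6MemberB8AtP13)
open Summit.QuantumFields.YangMills.Theorems.K0PrintCubeOfStepTokensR (gauge9Supplier_of_prop6MemberP)
open Summit.QuantumFields.YangMills.BalabanUVNodes.N07Thm1Top7FromProp8 (variationalThm1RegSepCoP7M_of_prop8TopStep)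
open Summit.QuantumFields.YangMills.Theorems.K0Stub3RunwiseFace
  (rgEqH_genSeq_of_inInterval nonneg_of_runConstRemainder_zero run3R_of_abs3A')

/-! ## §0  Generic: the (2.4) profile along 2-comparable couplings; 2-comparability from a run-wise β-bound; 3ᴿ's letter ⟹ the comparability letter -/

section Generic

/-- **★ BOTH COMPARABILITY CLAUSES ALONG `genSeq β g₀` FROM THE WINDOW `γ ≤ ½` AND THE 2-COMPARABILITY OF CONSECUTIVE COUPLINGS ALONG THAT RUN** — move (ii) alone: NO β-value is read
(`Node00.epsOfRecord_le_two_mul_of_le_two_mul`, `p₀ = 1`, `0 ≤ A₀`).  CONDITIONAL on the displayed comparability. [cite: Balaban1988Convergent, (2.4) p.255, (2.6)–(2.8) pp.255–256] -/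
theorem hcompBoth_genSeq_of_twoComparable (ν : Stage7Numerics) (hp : ν.p₀ = 1) (hA : 0 ≤ ν.A₀) {β : HBeta} {g0 γ : ℝ} {n : ℕ}
    (hI : Step.InInterval γ n (genSeq β g0)) (hγ : γ ≤ 1 / 2)
    (hC : ∀ m, m < n → genSeq β g0 m ≤ 2 * genSeq β g0 (m + 1) ∧ genSeq β g0 (m + 1) ≤ 2 * genSeq β g0 m) :
    (∀ m, m < n → epsOfRecord ν (genSeq β g0) m ≤ 2 * epsOfRecord ν (genSeq β g0) (m + 1)) ∧
    (∀ m, m < n → epsOfRecord ν (genSeq β g0) (m + 1) ≤ 2 * epsOfRecord ν (genSeq β g0) m) := by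
  refine ⟨fun m hm => ?_, fun m hm => ?_⟩
  · have hgm := hI m hm.le
    have hgm' := hI (m + 1) hm
    exact epsOfRecord_le_two_mul_of_le_two_mul ν hp hA hgm.1 hgm'.1 (hgm.2.trans hγ) (hgm'.2.trans hγ) (hC m hm).1
  · have hgm := hI m hm.le
    have hgm' := hI (m + 1) hm
    exact epsOfRecord_le_two_mul_of_le_two_mul ν hp hA hgm'.1 hgm.1 (hgm'.2.trans hγ) (hgm.2.trans hγ) (hC m hm).2

/-- **MOVE (i) EXPOSED — 2-COMPARABILITY ALONG A SOLUTION OF (0.20) FROM A TWO-SIDED β-BOUND READ ALONG IT**: `bₗ ≤ β_m(g_0,…,g_m) ≤ β′` for `m < n` along an in-window solution `gs` (`0 < g_j ≤ γ`,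
`j ≤ n`), letters `−bₗ·γ² ≤ 3`, `β′·γ² ≤ ¾` ⟹ `g_m ≤ 2g_{m+1}` and `g_{m+1} ≤ 2g_m` (`Node00.le_two_mul_of_inv_sq_step_lower ∕ _upper` on the step `g_{m+1}⁻² = g_m⁻² − β_m`).  CONDITIONAL.
[cite: Balaban1987RG1, (0.20) p.256, Thm 3 p.264; Balaban1988Convergent, (2.6) p.255] -/
theorem twoComparable_of_rgEqH_of_runBetaBox {β : HBeta} {gs : ℕ → ℝ} {γ bl β' : ℝ} {n : ℕ} (hrg : RGEqH n β gs) (hI : Step.InInterval γ n gs)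
    (hrun : ∀ m, m < n → bl ≤ β m (prefixOf gs m) ∧ β m (prefixOf gs m) ≤ β') (hl : -bl * γ ^ 2 ≤ 3) (hu : β' * γ ^ 2 ≤ 3 / 4) :
    ∀ m, m < n → gs m ≤ 2 * gs (m + 1) ∧ gs (m + 1) ≤ 2 * gs m := by
  intro m hm
  have hgm := hI m hm.le
  have hgm' := hI (m + 1) hm
  have hβlo := (hrun m hm).1
  have hβup := (hrun m hm).2
  have hid : (gs (m + 1) ^ 2)⁻¹ = (gs m ^ 2)⁻¹ - β m (prefixOf gs m) := by
    have h := hrg m hm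
    rw [one_div, one_div] at h
    linarith
  have hg2 : gs m ^ 2 ≤ γ ^ 2 := pow_le_pow_left₀ hgm.1.le hgm.2 2
  have hg2nn : 0 ≤ gs m ^ 2 := sq_nonneg _
  refine ⟨le_two_mul_of_inv_sq_step_lower (t := -bl) hgm.1 hgm'.1 (by rw [hid]; linarith) ?_,
    le_two_mul_of_inv_sq_step_upper (t := β') hgm.1 hgm'.1 (by rw [hid]; linarith) ?_⟩
  · rcases le_or_gt 0 bl with hbl | hbl
    · nlinarith [hg2nn, hbl]
    · exact (mul_le_mul_of_nonneg_left hg2 (by linarith)).trans hl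
  · rcases le_or_gt 0 β' with hb' | hb'
    · exact (mul_le_mul_of_nonneg_left hg2 hb').trans hu
    · nlinarith [hg2nn, hb']

/-- The comparability letter is antitone in the level: in-window runs of level `γ′ ≤ γ` are in-window runs of level `γ`. [folklore] -/
theorem twoComparable_mono {β : HBeta} {γ γ' : ℝ} (hle : γ' ≤ γ)
    (h : ∀ (n : ℕ) (gs : ℕ → ℝ), RGEqH n β gs → Step.InInterval γ n gs → ∀ m, m < n → gs m ≤ 2 * gs (m + 1) ∧ gs (m + 1) ≤ 2 * gs m) :
    ∀ (n : ℕ) (gs : ℕ → ℝ), RGEqH n β gs → Step.InInterval γ' n gs → ∀ m, m < n → gs m ≤ 2 * gs (m + 1) ∧ gs (m + 1) ≤ 2 * gs m :=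
  fun n gs hrg hI => h n gs hrg fun j hj => ⟨(hI j hj).1, (hI j hj).2.trans hle⟩

/-- **★ 3ᴿ's LETTER ⟹ THE COMPARABILITY LETTER ON A SMALLER LEVEL**: `RunConstRemainder β 0 β′ γ₀` (`γ₀ > 0`) gives a level `γ ∈ ]0, γ₀]`, `γ ≤ ½`, on which consecutive couplings of every
in-window solution of (0.20) are 2-comparable (`0 ≤ β′` from the one-point run; window shrink `Node00.exists_window_letters_signFree`; move (i)).  The converse is NOT claimed (3ᶜ allows
`|β_m| ~ g_m⁻²`). [cite: Balaban1987RG1, (0.20) p.256, Thm 3 p.264, §1 p.264; Balaban1988Convergent, (2.6)–(2.8) pp.255–256] -/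
theorem exists_twoComparable_of_runConstRemainder {β : HBeta} {γ₀ β' : ℝ} (hγ₀ : 0 < γ₀) (hR : RunConstRemainder β (fun _ => 0) β' γ₀) :
    ∃ γ : ℝ, 0 < γ ∧ γ ≤ γ₀ ∧ γ ≤ 1 / 2 ∧
      ∀ (n : ℕ) (gs : ℕ → ℝ), RGEqH n β gs → Step.InInterval γ n gs → ∀ m, m < n → gs m ≤ 2 * gs (m + 1) ∧ gs (m + 1) ≤ 2 * gs m := by
  have hβ' : 0 ≤ β' := nonneg_of_runConstRemainder_zero hγ₀ hR
  obtain ⟨γ, hγpos, hγle, hγhalf, -, hu⟩ := exists_window_letters_signFree hγ₀ hβ'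
  refine ⟨γ, hγpos, hγle, hγhalf, fun n gs hrg hI => ?_⟩
  have hR' := hR.mono hγle
  refine twoComparable_of_rgEqH_of_runBetaBox hrg hI (bl := -β') (β' := β') (fun m hm => ?_) (by rw [neg_neg]; linarith) hu
  have h := hR' n gs hrg hI m hm.le
  rw [sub_zero] at h
  exact ⟨(abs_le.mp h).1, (abs_le.mp h).2⟩

end Generic

/-! ## §1  θ-generic: both history clauses of row `bg` along every windowed run of a Stage-13 parameter from the comparability letter at level `θ.γ ≤ ½` -/

section ThetaGeneric

variable {F : T4Family} {N : ℕ} [NeZero N]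

/-- **★ (hcomp) ∧ (hcompRev) AT A GENERIC `θ : Stage13Params F N` FROM THE COMPARABILITY LETTER AT LEVEL `θ.γ ≤ ½`** (`p₀ = 1`, `0 ≤ A₀`, `0 ≤ cR`): the in-window generated run
`gOfRecord₁₃ θ p = genSeq β₁₃(θ) g₀(p)` solves (0.20) (`rgEqH_genSeq_of_inInterval`), so the letter applies to it and move (ii) concludes.  NO value of β is read.  CONDITIONAL.
[cite: Balaban1988Convergent, (2.4) p.255, (2.6)–(2.8) pp.255–256; Balaban1987RG1, (0.20) p.256] -/
theorem hcompBoth_of_twoComparable (θ : Stage13Params F N) (hA : 0 ≤ θ.ν.A₀) (hp : θ.ν.p₀ = 1) (hγ : θ.γ ≤ 1 / 2) (hcR : 0 ≤ θ.s2.cR)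
    (hC : ∀ (n : ℕ) (gs : ℕ → ℝ), RGEqH n (betaOfRecord₁₃ F N θ) gs → Step.InInterval θ.γ n gs → ∀ m, m < n → gs m ≤ 2 * gs (m + 1) ∧ gs (m + 1) ≤ 2 * gs m) :
    (∀ (p : B12.RunParams) (n : ℕ), n ≤ p.K → Step.InInterval θ.γ n (gOfRecord₁₃ F N θ p) → ∀ m, m < n →
      θ.s2.cR * epsOfRecord θ.ν (gOfRecord₁₃ F N θ p) m ≤ 2 * (θ.s2.cR * epsOfRecord θ.ν (gOfRecord₁₃ F N θ p) (m + 1))) ∧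
    (∀ (p : B12.RunParams) (n : ℕ), n ≤ p.K → Step.InInterval θ.γ n (gOfRecord₁₃ F N θ p) → ∀ m, m < n →
      θ.s2.cR * epsOfRecord θ.ν (gOfRecord₁₃ F N θ p) (m + 1) ≤ 2 * (θ.s2.cR * epsOfRecord θ.ν (gOfRecord₁₃ F N θ p) m)) :=
  ⟨fun _ n _ hw => hcomp_mul_of_hcomp θ.ν hcR
      (hcompBoth_genSeq_of_twoComparable θ.ν hp hA hw hγ (hC n _ (rgEqH_genSeq_of_inInterval hw) hw)).1,
    fun _ n _ hw => hcompRev_mul_of_hcompRev θ.ν hcR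
      (hcompBoth_genSeq_of_twoComparable θ.ν hp hA hw hγ (hC n _ (rgEqH_genSeq_of_inInterval hw) hw)).2⟩

end ThetaGeneric

/-! ## §2  At the windowed collared witness `θ₁₅ᶜᶜᴹ(j; γ)`: the transfer along runs and both clauses from the comparability letter of A1's witness `θ₁₅ᶜᶜᴹ(j)` at level `γ ≤ ½` -/

section AtWitnessW

variable {F : T4Family} {N : ℕ} [NeZero N] {j : ℕ} {γ ε₀ ε₂₉ B₃ B₃' a₀ a₁ : ℝ}

/-- **THE COMPARABILITY LETTER OF A1's WITNESS AT LEVEL `γ ≤ ½` IS ONE OF THE WINDOW EDITION**: on in-window prefixes the two β's coincide (A2ʷ `betaOfRecord₁₃_theta13OfThm1CCMW_eq_of_mem`), so a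
solution of (0.20) for the window edition is one for A1's witness. [cite: Balaban1987RG1, (1.20)–(1.22) p.264, (0.20) p.256 (bookkeeping)] -/
theorem twoComparable_theta13OfThm1CCMW_of_half (hγ : γ ≤ 1 / 2)
    (h : ∀ (n : ℕ) (gs : ℕ → ℝ), RGEqH n (betaOfRecord₁₃ F N (theta13OfThm1CCM F N j ε₀ ε₂₉ B₃ B₃' a₀ a₁)) gs → Step.InInterval γ n gs →
      ∀ m, m < n → gs m ≤ 2 * gs (m + 1) ∧ gs (m + 1) ≤ 2 * gs m) :
    ∀ (n : ℕ) (gs : ℕ → ℝ), RGEqH n (betaOfRecord₁₃ F N (theta13OfThm1CCMW F N j γ ε₀ ε₂₉ B₃ B₃' a₀ a₁)) gs → Step.InInterval γ n gs →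
      ∀ m, m < n → gs m ≤ 2 * gs (m + 1) ∧ gs (m + 1) ≤ 2 * gs m := by
  intro n gs hrg hI
  refine h n gs (fun k' hk' => ?_) hI
  have hbox : prefixOf gs k' ∈ Box γ k' := mem_box.mpr fun i => hI i ((Nat.lt_succ_iff.mp i.isLt).trans hk'.le)
  rw [← betaOfRecord₁₃_theta13OfThm1CCMW_eq_of_mem (j := j) (γ := γ) hγ hbox]
  exact hrg k' hk'

/-- **★ (hcomp) ∧ (hcompRev) AT `θ₁₅ᶜᶜᴹ(j; γ)` FROM THE COMPARABILITY LETTER OF A1's WITNESS AT LEVEL `γ ≤ ½`** (weak signs of the class constants; `θ₁₅ᶜᶜᴹ(j; γ).γ = γ`, `p₀ = 1`, `cR = 1`,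
`A₀ = A₀ᶜᶜ¹ ≥ 0`) — §2's transfer then §1.  CONDITIONAL on the displayed letter. [cite: Balaban1988Convergent, (2.4) p.255, (2.6)–(2.8) pp.255–256; Balaban1987RG1, (0.20) p.256, (1.20)–(1.22) p.264] -/
theorem hcompBoth_theta13OfThm1CCMW_of_twoComparable_half (hγ : γ ≤ 1 / 2) (hB : 0 ≤ B₃) (hB' : 0 ≤ B₃') (ha₀ : 0 ≤ a₀) (ha₁ : 0 ≤ a₁)
    (hC : ∀ (n : ℕ) (gs : ℕ → ℝ), RGEqH n (betaOfRecord₁₃ F N (theta13OfThm1CCM F N j ε₀ ε₂₉ B₃ B₃' a₀ a₁)) gs → Step.InInterval γ n gs →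
      ∀ m, m < n → gs m ≤ 2 * gs (m + 1) ∧ gs (m + 1) ≤ 2 * gs m) :
    (∀ (p : B12.RunParams) (n : ℕ), n ≤ p.K → Step.InInterval (theta13OfThm1CCMW F N j γ ε₀ ε₂₉ B₃ B₃' a₀ a₁).γ n (gOfRecord₁₃ F N (theta13OfThm1CCMW F N j γ ε₀ ε₂₉ B₃ B₃' a₀ a₁) p) → ∀ m, m < n →
      (theta13OfThm1CCMW F N j γ ε₀ ε₂₉ B₃ B₃' a₀ a₁).s2.cR * epsOfRecord (theta13OfThm1CCMW F N j γ ε₀ ε₂₉ B₃ B₃' a₀ a₁).ν (gOfRecord₁₃ F N (theta13OfThm1CCMW F N j γ ε₀ ε₂₉ B₃ B₃' a₀ a₁) p) m ≤ 2 * ((theta13OfThm1CCMW F N j γ ε₀ ε₂₉ B₃ B₃' a₀ a₁).s2.cR * epsOfRecord (theta13OfThm1CCMW F N j γ ε₀ ε₂₉ B₃ B₃' a₀ a₁).ν (gOfRecord₁₃ F N (theta13OfThm1CCMW F N j γ ε₀ ε₂₉ B₃ B₃' a₀ a₁) p) (m + 1))) ∧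
    (∀ (p : B12.RunParams) (n : ℕ), n ≤ p.K → Step.InInterval (theta13OfThm1CCMW F N j γ ε₀ ε₂₉ B₃ B₃' a₀ a₁).γ n (gOfRecord₁₃ F N (theta13OfThm1CCMW F N j γ ε₀ ε₂₉ B₃ B₃' a₀ a₁) p) → ∀ m, m < n →
      (theta13OfThm1CCMW F N j γ ε₀ ε₂₉ B₃ B₃' a₀ a₁).s2.cR * epsOfRecord (theta13OfThm1CCMW F N j γ ε₀ ε₂₉ B₃ B₃' a₀ a₁).ν (gOfRecord₁₃ F N (theta13OfThm1CCMW F N j γ ε₀ ε₂₉ B₃ B₃' a₀ a₁) p) (m + 1) ≤ 2 * ((theta13OfThm1CCMW F N j γ ε₀ ε₂₉ B₃ B₃' a₀ a₁).s2.cR * epsOfRecord (theta13OfThm1CCMW F N j γ ε₀ ε₂₉ B₃ B₃' a₀ a₁).ν (gOfRecord₁₃ F N (theta13OfThm1CCMW F N j γ ε₀ ε₂₉ B₃ B₃' a₀ a₁) p) m)) := by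
  have hγ' := theta13OfThm1CCMW_γ F N j γ ε₀ ε₂₉ B₃ B₃' a₀ a₁
  refine hcompBoth_of_twoComparable (theta13OfThm1CCMW F N j γ ε₀ ε₂₉ B₃ B₃' a₀ a₁)
    (by rw [theta13OfThm1CCMW_A₀]; exact A0OfThm1CC1_nonneg hB hB' ha₀ ha₁) (theta13OfThm1CCMW_p₀ F N j γ ε₀ ε₂₉ B₃ B₃' a₀ a₁) (by rw [hγ']; exact hγ)
    (by rw [theta13OfThm1CCMW_cR]; norm_num) ?_
  rw [hγ']
  exact twoComparable_theta13OfThm1CCMW_of_half hγ hC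

end AtWitnessW

/-! ## §3  ★ ONE comparability letter of `θ₁₅ᶜᶜᴹ(j)` ⟹ the clauses at `θ₁₅ᶜᶜᴹᵂ(j; γ)`; K0⁷'s body at `F` at the cube letter `(L^j, c)` -/

section Body

variable (F : T4Family) (j : ℕ) {B₃ B₃' a₀ a₁ : ℝ}

/-- **★ ONE COMPARABILITY LETTER ⟹ THE CLAUSES, AT ANY INDEX `j`**: the letter of `β₁₃(θ₁₅ᶜᶜᴹ(j; ε₀, ε₂₉))` at some level `γ₀ > 0` (thresholds chosen with it) gives a window `γ := min γ₀ ½` with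
(hcomp) ∧ (hcompRev) along every `γ`-windowed run of `θ₁₅ᶜᶜᴹᵂ(j; γ)` (level restriction `twoComparable_mono`, then §2).  No (8)∕(9) token, no β-value read.  CONDITIONAL on the letter.
[cite: Balaban1988Convergent, (2.4)–(2.8) pp.255–256; Balaban1987RG1, Thm 1 p.259, (0.20) p.256, (1.20)–(1.22) p.264] -/
theorem clausesH_of_twoComparable (hB : 0 ≤ B₃) (hB' : 0 ≤ B₃') (ha₀ : 0 ≤ a₀) (ha₁ : 0 ≤ a₁)
    (h : ∃ γ₀ ε₀ ε₂₉ : ℝ, 0 < γ₀ ∧ 0 < ε₀ ∧ 0 < ε₂₉ ∧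
        ∀ (n : ℕ) (gs : ℕ → ℝ), RGEqH n (betaOfRecord₁₃ F 2 (theta13OfThm1CCM F 2 j ε₀ ε₂₉ B₃ B₃' a₀ a₁)) gs → Step.InInterval γ₀ n gs →
          ∀ m, m < n → gs m ≤ 2 * gs (m + 1) ∧ gs (m + 1) ≤ 2 * gs m) :
    ∃ γ ε₀ ε₂₉ : ℝ, 0 < γ ∧ γ ≤ 1 / 2 ∧ 0 < ε₀ ∧ 0 < ε₂₉ ∧
        (∀ (p : B12.RunParams) (n : ℕ), n ≤ p.K → Step.InInterval (theta13OfThm1CCMW F 2 j γ ε₀ ε₂₉ B₃ B₃' a₀ a₁).γ n (gOfRecord₁₃ F 2 (theta13OfThm1CCMW F 2 j γ ε₀ ε₂₉ B₃ B₃' a₀ a₁) p) → ∀ m, m < n →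
          (theta13OfThm1CCMW F 2 j γ ε₀ ε₂₉ B₃ B₃' a₀ a₁).s2.cR * epsOfRecord (theta13OfThm1CCMW F 2 j γ ε₀ ε₂₉ B₃ B₃' a₀ a₁).ν (gOfRecord₁₃ F 2 (theta13OfThm1CCMW F 2 j γ ε₀ ε₂₉ B₃ B₃' a₀ a₁) p) m ≤
            2 * ((theta13OfThm1CCMW F 2 j γ ε₀ ε₂₉ B₃ B₃' a₀ a₁).s2.cR * epsOfRecord (theta13OfThm1CCMW F 2 j γ ε₀ ε₂₉ B₃ B₃' a₀ a₁).ν (gOfRecord₁₃ F 2 (theta13OfThm1CCMW F 2 j γ ε₀ ε₂₉ B₃ B₃' a₀ a₁) p) (m + 1))) ∧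
        (∀ (p : B12.RunParams) (n : ℕ), n ≤ p.K → Step.InInterval (theta13OfThm1CCMW F 2 j γ ε₀ ε₂₉ B₃ B₃' a₀ a₁).γ n (gOfRecord₁₃ F 2 (theta13OfThm1CCMW F 2 j γ ε₀ ε₂₉ B₃ B₃' a₀ a₁) p) → ∀ m, m < n →
          (theta13OfThm1CCMW F 2 j γ ε₀ ε₂₉ B₃ B₃' a₀ a₁).s2.cR * epsOfRecord (theta13OfThm1CCMW F 2 j γ ε₀ ε₂₉ B₃ B₃' a₀ a₁).ν (gOfRecord₁₃ F 2 (theta13OfThm1CCMW F 2 j γ ε₀ ε₂₉ B₃ B₃' a₀ a₁) p) (m + 1) ≤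
            2 * ((theta13OfThm1CCMW F 2 j γ ε₀ ε₂₉ B₃ B₃' a₀ a₁).s2.cR * epsOfRecord (theta13OfThm1CCMW F 2 j γ ε₀ ε₂₉ B₃ B₃' a₀ a₁).ν (gOfRecord₁₃ F 2 (theta13OfThm1CCMW F 2 j γ ε₀ ε₂₉ B₃ B₃' a₀ a₁) p) m)) := by
  obtain ⟨γ₀, ε₀, ε₂₉, hγ0, hε, hε', hC⟩ := h
  refine ⟨min γ₀ (1 / 2), ε₀, ε₂₉, lt_min hγ0 (by norm_num), min_le_right _ _, hε, hε',
    hcompBoth_theta13OfThm1CCMW_of_twoComparable_half (min_le_right γ₀ (1 / 2)) hB hB' ha₀ ha₁ (twoComparable_mono (min_le_left γ₀ (1 / 2)) hC)⟩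

variable {j} {c : ℕ}

/-- **★ THE ⁷ K0 BODY FOR `F` AT AN ARBITRARY CUBE LETTER FROM (8), THE (9)-TOKEN AND ONE COMPARABILITY LETTER** (`N = 2`, `M = M₁ = L^j`, `c ≤ L^j`, EVERY family): `clausesH_of_twoComparable` then
the all-torus closer `exists_k0SepCoPH_thm1CCMW_of_gauge9TopStepR_of_hcomp_allTorus` (p575996).  `…K0Stub3RunwiseFace` §3's twin with 3ᴿ's clause replaced by 3ᶜ's.  CONDITIONAL.
[cite: Balaban1985Variational, Thm 1 (8)–(9) p.279, (144)–(152) pp.300–301, Prop. 8 p.304; Balaban1988Convergent, Thm 1 p.262, (2.6)–(2.8) pp.255–256, p.257, (2.21) p.258; Balaban1987RG1, Thm 1 p.259, (1.12) p.262] -/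
theorem exists_k0H_of_thm1CoP7M_of_gauge9R_of_twoComparable (hc : c ≤ F.L ^ j) {B₃ B₉ a₀ a₁ : ℝ} (hB₃ : 0 ≤ B₃) (hB₉ : 0 ≤ B₉)
    (ha₀ : 0 < a₀) (ha₁ : 0 < a₁) (h15 : VariationalThm1RegSepCoP7M F 2 B₃ a₀ a₁)
    (h9 : Gauge9RegSepTopStepR F 2 (fun ν K Ω => suppDomOfRecord F ν K Ω) (F.L ^ j) c B₃ B₉ a₀ a₁)
    (h3C : ∃ γ₀ ε₀ ε₂₉ : ℝ, 0 < γ₀ ∧ 0 < ε₀ ∧ 0 < ε₂₉ ∧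
        ∀ (n : ℕ) (gs : ℕ → ℝ), RGEqH n (betaOfRecord₁₃ F 2 (theta13OfThm1CCM F 2 j ε₀ ε₂₉ B₃ B₉ a₀ a₁)) gs → Step.InInterval γ₀ n gs →
          ∀ m, m < n → gs m ≤ 2 * gs (m + 1) ∧ gs (m + 1) ≤ 2 * gs m) :
    ∃ θ : Stage13HParams F 2, θ.Provisos₁₃SepCoPH F 2 ∧ (θ.ZhUnity F 2 ∧ θ.SlotsNondegenerate₁₃ F 2) ∧ θ.Admissible F 2 := by
  obtain ⟨γ, ε₀, ε₂₉, hγ0, hγ, hε, hε', hcomp, hcompRev⟩ := clausesH_of_twoComparable F j hB₃ hB₉ ha₀.le ha₁.le h3C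
  exact exists_k0SepCoPH_thm1CCMW_of_gauge9TopStepR_of_hcomp_allTorus F hγ0 hγ hε hε' hB₃ hB₉ ha₀ ha₁ h15 hc h9 hcomp hcompRev

end Body

/-! ## §4  Stub level: K0⁷ BY NAME from the texts of stubs 1, 2′ and the comparability face 3ᶜ; 3ᴿ ⟹ 3ᶜ; 3ᴬ′ ⟹ 3ᶜ; V19's composition factors through 3ᶜ -/

section Stubs

/-- **★★ K0⁷'s BODY AT EVERY FAMILY FROM STUB 1, A GENERIC (9)-SUPPLIER, AND 3ᶜ** — `…K0Stub3RunwiseFace.record13SepCoPHBody_of_stub1_of_gauge9Supplier_of_runAbsBetaBoxAt` with 3ᴿ's clause replaced by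
3ᶜ's (stub 1 ⇒ (8) at the shrunk ceiling via N07's bridge, `hS` ⇒ (9), `h3C` there ⇒ §3).  CONDITIONAL; K0⁷ NOT closed; nothing of Bałaban asserted.
[cite: Balaban1985Variational, Thm 1 (8)–(9) p.279, (152) p.301, Prop. 8 p.304; Balaban1985RegularSpaces, Prop. 6 p.99, p.98; Balaban1988Convergent, Thm 1 p.262, (2.6)–(2.8) pp.255–256, p.257; Balaban1987RG1, Thm 1 p.259] -/
theorem record13SepCoPHBody_of_stub1_of_gauge9Supplier_of_twoComparableAt
    (h1 : ∀ F : T4Family, ∃ B₃ a₀ a₁ : ℝ, 2 * (F.L : ℝ) ^ 2 ≤ B₃ ∧ 0 < a₀ ∧ 0 < a₁ ∧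
      Prop8RegSepTopStep F 2 (fun ν K Ω => suppDomOfRecord F ν K Ω) B₃ a₀ a₁)
    (hS : ∀ (F : T4Family) (B₃ a₀ a₁ : ℝ), 2 * (F.L : ℝ) ^ 2 ≤ B₃ → 0 < a₀ → 0 < a₁ →
      Prop8RegSepTopStep F 2 (fun ν K Ω => suppDomOfRecord F ν K Ω) B₃ a₀ a₁ →
      ∃ (j c : ℕ) (B₉ a₁' : ℝ), c ≤ F.L ^ j ∧ 0 < B₉ ∧ 0 < a₁' ∧ a₁' ≤ a₁ ∧
        Gauge9RegSepTopStepR F 2 (fun ν K Ω => suppDomOfRecord F ν K Ω) (F.L ^ j) c B₃ B₉ a₀ a₁')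
    (h3C : ∀ (F : T4Family) (j c : ℕ) (B₃ B₃' a₀ a₁ : ℝ), c ≤ F.L ^ j → 2 * (F.L : ℝ) ^ 2 ≤ B₃ → 0 < B₃' → 0 < a₀ → 0 < a₁ →
      VariationalThm1RegSepCoP7M F 2 B₃ a₀ a₁ →
      Gauge9RegSepTopStepR F 2 (fun ν K Ω => suppDomOfRecord F ν K Ω) (F.L ^ j) c B₃ B₃' a₀ a₁ →
      ∃ γ₀ ε₀ ε₂₉ : ℝ, 0 < γ₀ ∧ 0 < ε₀ ∧ 0 < ε₂₉ ∧
        ∀ (n : ℕ) (gs : ℕ → ℝ), RGEqH n (betaOfRecord₁₃ F 2 (theta13OfThm1CCM F 2 j ε₀ ε₂₉ B₃ B₃' a₀ a₁)) gs → Step.InInterval γ₀ n gs →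
          ∀ m, m < n → gs m ≤ 2 * gs (m + 1) ∧ gs (m + 1) ≤ 2 * gs m) :
    ∀ F : T4Family, ∃ θ : Stage13HParams F 2, θ.Provisos₁₃SepCoPH F 2 ∧ (θ.ZhUnity F 2 ∧ θ.SlotsNondegenerate₁₃ F 2) ∧ θ.Admissible F 2 := by
  intro F
  obtain ⟨B₃, a₀, a₁, hB₃, ha₀, ha₁, h8⟩ := h1 F
  have hL : (0 : ℝ) < (F.L : ℝ) := by exact_mod_cast lt_trans Nat.zero_lt_one F.hL.2
  have hBpos : (0 : ℝ) < B₃ := lt_of_lt_of_le (mul_pos two_pos (pow_pos hL 2)) hB₃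
  obtain ⟨j, c, B₉, a₁', hc, hB₉, ha₁', ha₁'le, h9⟩ := hS F B₃ a₀ a₁ hB₃ ha₀ ha₁ h8
  have h15 : VariationalThm1RegSepCoP7M F 2 B₃ a₀ a₁' := variationalThm1RegSepCoP7M_of_prop8TopStep hBpos (h8.of_le le_rfl ha₁'le)
  exact exists_k0H_of_thm1CoP7M_of_gauge9R_of_twoComparable F hc hBpos.le hB₉.le ha₀ ha₁' h15 h9 (h3C F j c B₃ B₉ a₀ a₁' hc hB₃ hB₉ ha₀ ha₁' h15 h9)

/-- **★★ K0⁷ BY NAME FROM THE TEXTS OF STUBS 1, 2′ AND THE COMPARABILITY FACE 3ᶜ** (PART 2's supplier `gauge9Supplier_of_prop6MemberP` fills the slot).  CONDITIONAL on the three texts; K0⁷ OPEN;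
V19 STANDS (3ᶜ is a displayed hypothesis). [cite: Balaban1985Variational, Thm 1 (8)–(9) p.279, (144)–(152) pp.300–301, Prop. 8 p.304; Balaban1985RegularSpaces, Prop. 6 p.99, p.98; Balaban1988Convergent, Thm 1 p.262, (2.6)–(2.8) pp.255–256; Balaban1987RG1, Thm 1 p.259] -/
theorem record13SepCoPHInhabited_of_stub1_stub2P_comp3C (h1 : ∀ F : T4Family, Prop8StepCoPAt F) (h2P : ∀ F : T4Family, Prop6MemberB8AtP F)
    (h3C : ∀ (F : T4Family) (j c : ℕ) (B₃ B₃' a₀ a₁ : ℝ), c ≤ F.L ^ j → 2 * (F.L : ℝ) ^ 2 ≤ B₃ → 0 < B₃' → 0 < a₀ → 0 < a₁ →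
      VariationalThm1RegSepCoP7M F 2 B₃ a₀ a₁ →
      Gauge9RegSepTopStepR F 2 (fun ν K Ω => suppDomOfRecord F ν K Ω) (F.L ^ j) c B₃ B₃' a₀ a₁ →
      ∃ γ₀ ε₀ ε₂₉ : ℝ, 0 < γ₀ ∧ 0 < ε₀ ∧ 0 < ε₂₉ ∧
        ∀ (n : ℕ) (gs : ℕ → ℝ), RGEqH n (betaOfRecord₁₃ F 2 (theta13OfThm1CCM F 2 j ε₀ ε₂₉ B₃ B₃' a₀ a₁)) gs → Step.InInterval γ₀ n gs →
          ∀ m, m < n → gs m ≤ 2 * gs (m + 1) ∧ gs (m + 1) ≤ 2 * gs m) :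
    Summit.QuantumFields.YangMills.Theses.BalabanUVNodes.Record13SepCoPHInhabited :=
  record13SepCoPHBody_of_stub1_of_gauge9Supplier_of_twoComparableAt h1 (fun F => gauge9Supplier_of_prop6MemberP F (h2P F)) h3C

/-- **★★★ K0⁷ BY NAME FROM STUB 1's TEXT AND 3ᶜ ALONE** (stub 2′ by name, `K0V19Stub2Prime.stub_prop6MemberB8AtP13` p595104): on this road the open K0⁷ bill reads {stub 1 ([15] Prop. 8's top step),
3ᶜ (NODE O: 2-comparability of consecutive couplings along the in-window runs of the witness's β)}.  CONDITIONAL — displayed, NOT inhabited; K0⁷ OPEN.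
[cite: Balaban1985Variational, Thm 1 (8)–(9) p.279, Prop. 8 p.304; Balaban1985RegularSpaces, Prop. 6 p.99; Balaban1988Convergent, Thm 1 p.262, (2.6)–(2.8) pp.255–256; Balaban1987RG1, Thm 1 p.259, (0.20) p.256] -/
theorem record13SepCoPHInhabited_of_stub1_comp3C_byName (h1 : ∀ F : T4Family, Prop8StepCoPAt F)
    (h3C : ∀ (F : T4Family) (j c : ℕ) (B₃ B₃' a₀ a₁ : ℝ), c ≤ F.L ^ j → 2 * (F.L : ℝ) ^ 2 ≤ B₃ → 0 < B₃' → 0 < a₀ → 0 < a₁ →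
      VariationalThm1RegSepCoP7M F 2 B₃ a₀ a₁ →
      Gauge9RegSepTopStepR F 2 (fun ν K Ω => suppDomOfRecord F ν K Ω) (F.L ^ j) c B₃ B₃' a₀ a₁ →
      ∃ γ₀ ε₀ ε₂₉ : ℝ, 0 < γ₀ ∧ 0 < ε₀ ∧ 0 < ε₂₉ ∧
        ∀ (n : ℕ) (gs : ℕ → ℝ), RGEqH n (betaOfRecord₁₃ F 2 (theta13OfThm1CCM F 2 j ε₀ ε₂₉ B₃ B₃' a₀ a₁)) gs → Step.InInterval γ₀ n gs →
          ∀ m, m < n → gs m ≤ 2 * gs (m + 1) ∧ gs (m + 1) ≤ 2 * gs m) :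
    Summit.QuantumFields.YangMills.Theses.BalabanUVNodes.Record13SepCoPHInhabited :=
  record13SepCoPHInhabited_of_stub1_stub2P_comp3C h1 stub_prop6MemberB8AtP13 h3C

/-- **3ᴿ ⟹ 3ᶜ AT ONE FAMILY** (`exists_twoComparable_of_runConstRemainder`: the run letter at level `γ₀` gives the comparability letter at a level `γ ≤ min γ₀ ½`; same thresholds).  The converse is
NOT claimed. [cite: Balaban1987RG1, (0.20) p.256, Thm 3 p.264, §1 p.264; Balaban1988Convergent, (2.6)–(2.8) pp.255–256] -/
theorem comp3C_of_run3R (F : T4Family)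
    (h : ∀ (j c : ℕ) (B₃ B₃' a₀ a₁ : ℝ), c ≤ F.L ^ j → 2 * (F.L : ℝ) ^ 2 ≤ B₃ → 0 < B₃' → 0 < a₀ → 0 < a₁ →
      VariationalThm1RegSepCoP7M F 2 B₃ a₀ a₁ →
      Gauge9RegSepTopStepR F 2 (fun ν K Ω => suppDomOfRecord F ν K Ω) (F.L ^ j) c B₃ B₃' a₀ a₁ →
      ∃ γ₀ ε₀ ε₂₉ β' : ℝ, 0 < γ₀ ∧ 0 < ε₀ ∧ 0 < ε₂₉ ∧
        RunConstRemainder (betaOfRecord₁₃ F 2 (theta13OfThm1CCM F 2 j ε₀ ε₂₉ B₃ B₃' a₀ a₁)) (fun _ => 0) β' γ₀) :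
    ∀ (j c : ℕ) (B₃ B₃' a₀ a₁ : ℝ), c ≤ F.L ^ j → 2 * (F.L : ℝ) ^ 2 ≤ B₃ → 0 < B₃' → 0 < a₀ → 0 < a₁ →
      VariationalThm1RegSepCoP7M F 2 B₃ a₀ a₁ →
      Gauge9RegSepTopStepR F 2 (fun ν K Ω => suppDomOfRecord F ν K Ω) (F.L ^ j) c B₃ B₃' a₀ a₁ →
      ∃ γ₀ ε₀ ε₂₉ : ℝ, 0 < γ₀ ∧ 0 < ε₀ ∧ 0 < ε₂₉ ∧
        ∀ (n : ℕ) (gs : ℕ → ℝ), RGEqH n (betaOfRecord₁₃ F 2 (theta13OfThm1CCM F 2 j ε₀ ε₂₉ B₃ B₃' a₀ a₁)) gs → Step.InInterval γ₀ n gs →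
          ∀ m, m < n → gs m ≤ 2 * gs (m + 1) ∧ gs (m + 1) ≤ 2 * gs m := by
  intro j c B₃ B₃' a₀ a₁ hc hB₃ hB₃' ha₀ ha₁ h15 h9
  obtain ⟨γ₀, ε₀, ε₂₉, β', hγ0, hε, hε', hR⟩ := h j c B₃ B₃' a₀ a₁ hc hB₃ hB₃' ha₀ ha₁ h15 h9
  obtain ⟨γ, hγpos, -, -, hC⟩ := exists_twoComparable_of_runConstRemainder hγ0 hR
  exact ⟨γ, ε₀, ε₂₉, hγpos, hε, hε', hC⟩

/-- **3ᴬ′ ⟹ 3ᶜ AT ONE FAMILY** (through 3ᴿ: `K0Stub3RunwiseFace.run3R_of_abs3A'`): the REGISTERED socket pays the comparability face.  The converse is NOT claimed.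
[cite: Balaban1987RG1, Thm 1 p.259, §1 p.264, Thm 3 p.264 (bookkeeping)] -/
theorem comp3C_of_abs3A' (F : T4Family) (h : AbsBetaBoxAtThm1WitnessCCMGenAt F) :
    ∀ (j c : ℕ) (B₃ B₃' a₀ a₁ : ℝ), c ≤ F.L ^ j → 2 * (F.L : ℝ) ^ 2 ≤ B₃ → 0 < B₃' → 0 < a₀ → 0 < a₁ →
      VariationalThm1RegSepCoP7M F 2 B₃ a₀ a₁ →
      Gauge9RegSepTopStepR F 2 (fun ν K Ω => suppDomOfRecord F ν K Ω) (F.L ^ j) c B₃ B₃' a₀ a₁ →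
      ∃ γ₀ ε₀ ε₂₉ : ℝ, 0 < γ₀ ∧ 0 < ε₀ ∧ 0 < ε₂₉ ∧
        ∀ (n : ℕ) (gs : ℕ → ℝ), RGEqH n (betaOfRecord₁₃ F 2 (theta13OfThm1CCM F 2 j ε₀ ε₂₉ B₃ B₃' a₀ a₁)) gs → Step.InInterval γ₀ n gs →
          ∀ m, m < n → gs m ≤ 2 * gs (m + 1) ∧ gs (m + 1) ≤ 2 * gs m :=
  comp3C_of_run3R F (run3R_of_abs3A' F h)

/-- sanity (kernel, an `example` — the statement coincides with `K0Stub3RunwiseFace.record13SepCoPHInhabited_of_stubTexts_via_run3R`, already landed): V19's BY-NAME composition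
FACTORS THROUGH 3ᶜ (the three registered texts give K0⁷ through the comparability road).  CONDITIONAL; nothing asserted. [cite: Balaban1987RG1, Thm 1 p.259, §1 p.264 (bookkeeping)] -/
example (h1 : ∀ F : T4Family, Prop8StepCoPAt F) (h2P : ∀ F : T4Family, Prop6MemberB8AtP F)
    (h3A' : ∀ F : T4Family, AbsBetaBoxAtThm1WitnessCCMGenAt F) :
    Summit.QuantumFields.YangMills.Theses.BalabanUVNodes.Record13SepCoPHInhabited :=
  record13SepCoPHInhabited_of_stub1_stub2P_comp3C h1 h2P fun F => comp3C_of_abs3A' F (h3A' F)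

end Stubs

/-! ## §5  Shape separation (a MODEL history family, not Bałaban's β): the comparability letter does NOT give back a run-wise uniform bound -/

section Separation

/-- **3ᶜ's LETTER IS STRICTLY WEAKER THAN 3ᴿ's AS A SHAPE** (kernel witness on a MODEL `HBeta`, nothing to do with the β of record): for the scale-covariant family
`β_{k+1}(g_0, …, g_k) := 1 ∕ (2·g_k²)` one RG step (0.20) gives `g_{k+1}² = 2·g_k²`, so consecutive couplings along EVERY solution are 2-comparable at EVERY level (the comparability
letter holds with no window restriction), while `|β_1(g_0)| = 1∕(2g_0²)` is unbounded on `]0, γ₀]`, so NO `RunConstRemainder β 0 β′ γ₀` holds at any level `γ₀ > 0`.  Hence the converse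
of `exists_twoComparable_of_runConstRemainder` fails in general: 3ᶜ asks less of a supplier than 3ᴿ. [folklore] -/
theorem twoComparable_not_runConstRemainder_model :
    (∀ (γ : ℝ) (n : ℕ) (gs : ℕ → ℝ), RGEqH n (fun k v => 1 / (2 * v (Fin.last k) ^ 2)) gs → Step.InInterval γ n gs →
        ∀ m, m < n → gs m ≤ 2 * gs (m + 1) ∧ gs (m + 1) ≤ 2 * gs m) ∧
    (∀ β' γ₀ : ℝ, 0 < γ₀ → ¬ RunConstRemainder (fun k v => 1 / (2 * v (Fin.last k) ^ 2)) (fun _ => 0) β' γ₀) := by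
  refine ⟨fun γ n gs hrg hI m hm => ?_, fun β' γ₀ hγ₀ hR => ?_⟩
  · have hgm := (hI m hm.le).1
    have hgm' := (hI (m + 1) hm).1
    have e := hrg m hm
    simp only [prefixOf_apply, Fin.val_last] at e
    -- e : 1 / gs m ^ 2 = 1 / gs (m + 1) ^ 2 + 1 / (2 * gs m ^ 2)
    have hhalf : 1 / (2 * gs m ^ 2) = (1 / gs m ^ 2) / 2 := by ring
    have e2 : 1 / gs (m + 1) ^ 2 = 1 / (2 * gs m ^ 2) := by linarith
    have e3 : gs (m + 1) ^ 2 = 2 * gs m ^ 2 := by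
      have h := congrArg (fun x : ℝ => x⁻¹) e2
      simpa only [one_div, inv_inv] using h
    constructor
    · refine (pow_le_pow_iff_left₀ hgm.le (by positivity) two_ne_zero).mp ?_
      nlinarith [e3, sq_nonneg (gs m)]
    · refine (pow_le_pow_iff_left₀ hgm'.le (by positivity) two_ne_zero).mp ?_
      nlinarith [e3, sq_nonneg (gs m)]
  · have hβ' : 0 ≤ β' := nonneg_of_runConstRemainder_zero hγ₀ hR
    set b : ℝ := 1 / (2 * (β' + 1)) with hb
    have hb0 : 0 < b := by positivity
    have hbb : b * (2 * (β' + 1)) = 1 := by rw [hb]; exact one_div_mul_cancel (by positivity)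
    set g : ℝ := min γ₀ b with hgdef
    have hg0 : 0 < g := lt_min hγ₀ hb0
    have hgγ : g ≤ γ₀ := min_le_left _ _
    have hgb : g ≤ b := min_le_right _ _
    have h := hR 0 (fun _ => g) (fun k hk => absurd hk (Nat.not_lt_zero k)) (fun _ _ => ⟨hg0, hgγ⟩) 0 le_rfl
    simp only [prefixOf_apply, sub_zero] at h
    rw [abs_of_pos (by positivity)] at h
    -- h : 1 / (2 * g ^ 2) ≤ β'
    have h1 : 1 ≤ β' * (2 * g ^ 2) := by
      have h' := mul_le_mul_of_nonneg_right h (by positivity : (0 : ℝ) ≤ 2 * g ^ 2)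
      rwa [one_div, inv_mul_cancel₀ (by positivity)] at h'
    have h2b : 2 * β' * b ≤ 1 := by linarith [hbb, hb0]
    have s1 : β' * (2 * g ^ 2) ≤ 2 * β' * b * g := by nlinarith [hgb, mul_nonneg hβ' hg0.le]
    have s2 : 2 * β' * b * g ≤ g := by nlinarith [h2b, hg0]
    have s3 : b ≤ 1 / 2 := by linarith [hbb, mul_nonneg hb0.le hβ']
    linarith

end Separation

end Summit.QuantumFields.YangMills.Theorems.K0Stub3ComparabilityFace

end
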